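import Summits.BirchSwinnertonDyer.BirchSwinnertonDyer.Theorems.ManinLocalTwoThreeQuarterEighthTranslate
import HarnessLib

/-!
# `T_p` commutes with `R₄`, `R₈` (`p ∤ N`) and imc's End-saturated Conway lattice `S^{G,R}` is a `𝕋^{(N)}`-module

Summit `BirchSwinnertonDyer`, sub-problem `BirchSwinnertonDyer`, route `ManinLocalTwoThree`; width seat `bsd-line-manin23-p2`
(gen 9), `--supports` the crux C2 `ManinOddAtFour` (stmt-BirchSwinnertonDyer-22967).  Continuation of
`ManinLocalTwoThreeQuarterEighthTranslate` (the `q`-expansion formulas for `R₄`, `R₈`) and of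
`ManinLocalTwoThreeCutLatticesHeckeStable` (the same statement for `S^G`, `M^G`, `S^T`): imc g18's row E-imc-127 calls the
`T_p`-stability (`p ∤ N`) of the cut lattices «formal»; here it is for `NeronConwayR.endSaturatedConwayLattice`.

PROVED here (sorry-free): `I_pow_add_neg_I_pow_odd_mul` (`c₄(pm) = c₄(m)`, `p` odd), `c8_odd_mul` (`c₈(pm) = c₈(m)`:
multiplication by an odd `p` permutes the odd residues mod `8`), **`heckeT_ramanujanFour_comm`** (`16 ∣ N`),
**`heckeT_ramanujanEight_comm`** (`64 ∣ N`), **`map_heckeT_endSaturatedConwayLattice_le`** (`4 ∣ N`, `p ∤ N` prime).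

Elementary.  BSD is not proved by this; Manin's conjecture is not proved by this.
-/

set_option autoImplicit false
set_option linter.dupNamespace false

noncomputable section

open scoped MatrixGroups ModularForm Real
open CongruenceSubgroup Matrix.SpecialLinearGroup UpperHalfPlane Complex
open Literature.NumberTheory.EllipticCurves Literature.NumberTheory.EllipticCurves.ModularForms
open Summit.BirchSwinnertonDyer.Rank1Residual.ManinAdditive
open Summit.BirchSwinnertonDyer.Rank1Residual.ManinAdditive.ConwayCut
open Summit.BirchSwinnertonDyer.Rank1Residual.ManinAdditive.NeronConway
open Summit.BirchSwinnertonDyer.Rank1Residual.ManinAdditive.NeronConwayR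

namespace Summit.BirchSwinnertonDyer.BirchSwinnertonDyer.Theorems.ManinLocalTwoThree

variable {N : ℕ} [NeZero N]

/-! ### `T_p` commutes with `R₄`, `R₈` (`p` odd) and preserves `S^{G,R}` -/

/-- `i^{pm} + (−i)^{pm} = i^m + (−i)^m` for odd `p`. -/
theorem I_pow_add_neg_I_pow_odd_mul {p : ℕ} (hp : Odd p) (m : ℕ) :
    Complex.I ^ (p * m) + (-Complex.I) ^ (p * m) = Complex.I ^ m + (-Complex.I) ^ m := by
  have h4 : Complex.I ^ 4 = 1 := Complex.I_pow_four
  have h4' : (-Complex.I) ^ 4 = 1 := by rw [neg_pow, h4]; norm_num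
  have hI : Complex.I ^ p = Complex.I ^ (p % 4) := by
    conv_lhs => rw [← Nat.div_add_mod p 4, pow_add, pow_mul, h4, one_pow, one_mul]
  have hI' : (-Complex.I) ^ p = (-Complex.I) ^ (p % 4) := by
    conv_lhs => rw [← Nat.div_add_mod p 4, pow_add, pow_mul, h4', one_pow, one_mul]
  obtain ⟨a, rfl⟩ := hp
  have hr : (2 * a + 1) % 4 = 1 ∨ (2 * a + 1) % 4 = 3 := by omega
  rw [pow_mul, pow_mul, hI, hI']
  rcases hr with hr | hr <;> rw [hr]
  · rw [pow_one, pow_one]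
  · have hI3 : Complex.I ^ 3 = -Complex.I := by rw [pow_succ, Complex.I_sq]; ring
    have hnI3 : (-Complex.I) ^ 3 = Complex.I := by rw [Odd.neg_pow (by decide : Odd 3), hI3, neg_neg]
    rw [hI3, hnI3, add_comm]

/-- **`T_p R₄ = R₄ T_p`** for `p ∤ N` prime (`16 ∣ N`, so `p` odd): both sides have `n`-th coefficient
`c₄(n)(a_{pn} + p·𝟙_{p ∣ n} a_{n/p})`, as `c₄(pn) = c₄(n)`. -/
theorem heckeT_ramanujanFour_comm (h16 : 16 ∣ N) {p : ℕ} [NeZero p] (hp : p.Prime) (hpN : ¬ p ∣ N)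
    (x : CuspForm (Gamma0 N) 2) :
    heckeT (Gamma0 N) 2 p (ramanujanFour N 2 x) = ramanujanFour N 2 (heckeT (Gamma0 N) 2 p x) := by
  have hp2 : p ≠ 2 := by rintro rfl; exact hpN ((show (2 : ℕ) ∣ 16 by norm_num).trans h16)
  have hodd : Odd p := hp.odd_of_ne_two hp2
  refine eq_of_forall_cuspCoeff_eq_gamma0 fun n => ?_
  simp only [cuspCoeff_heckeT_weight_two hp, cuspCoeff_ramanujanFour_two h16, if_neg hpN]
  rw [I_pow_add_neg_I_pow_odd_mul hodd]
  by_cases hpn : p ∣ n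
  · obtain ⟨m, rfl⟩ := hpn
    rw [if_pos (dvd_mul_right p m), if_pos (dvd_mul_right p m), Nat.mul_div_cancel_left m hp.pos,
      I_pow_add_neg_I_pow_odd_mul hodd]
    ring
  · rw [if_neg hpn, if_neg hpn]
    ring

/-- `ζ₈ = e^{2πi/8}` satisfies `ζ₈⁸ = 1`. -/
theorem cexp_two_pi_I_eighth_pow_eight : cexp (2 * π * Complex.I * ((((1 : ℕ) : ℤ) : ℝ) / (8 : ℕ) : ℝ)) ^ 8 = 1 := by
  rw [show (8 : ℕ) = 4 * 2 from rfl, pow_mul, cexp_two_pi_I_eighth_pow_four]; norm_num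

/-- **`c₈(pm) = c₈(m)` for odd `p`**: multiplication by `p` permutes the odd residues mod `8`. -/
theorem c8_odd_mul {p : ℕ} (hp : Odd p) (m : ℕ) :
    let ζ := cexp (2 * π * Complex.I * ((((1 : ℕ) : ℤ) : ℝ) / (8 : ℕ) : ℝ))
    (ζ ^ 1) ^ (p * m) + (ζ ^ 3) ^ (p * m) + (ζ ^ 5) ^ (p * m) + (ζ ^ 7) ^ (p * m) =
      (ζ ^ 1) ^ m + (ζ ^ 3) ^ m + (ζ ^ 5) ^ m + (ζ ^ 7) ^ m := by
  intro ζ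
  have h8 : ζ ^ 8 = 1 := cexp_two_pi_I_eighth_pow_eight
  have hmod : ∀ a, ζ ^ a = ζ ^ (a % 8) := fun a => by
    conv_lhs => rw [← Nat.div_add_mod a 8, pow_add, pow_mul, h8, one_pow, one_mul]
  have hup : ∀ u, (ζ ^ u) ^ (p * m) = (ζ ^ ((u % 8) * (p % 8) % 8)) ^ m := fun u => by
    have e : (ζ ^ u) ^ (p * m) = (ζ ^ (u * p)) ^ m := by rw [← pow_mul, ← pow_mul, mul_assoc]
    rw [e, hmod (u * p), Nat.mul_mod]
  obtain ⟨a, rfl⟩ := hp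
  have hr : (2 * a + 1) % 8 = 1 ∨ (2 * a + 1) % 8 = 3 ∨ (2 * a + 1) % 8 = 5 ∨ (2 * a + 1) % 8 = 7 := by omega
  rw [hup 1, hup 3, hup 5, hup 7]
  rcases hr with hr | hr | hr | hr <;> rw [hr] <;> norm_num <;> ring

/-- **`T_p R₈ = R₈ T_p`** for `p ∤ N` prime (`64 ∣ N`, so `p` odd). -/
theorem heckeT_ramanujanEight_comm (h64 : 64 ∣ N) {p : ℕ} [NeZero p] (hp : p.Prime) (hpN : ¬ p ∣ N)
    (x : CuspForm (Gamma0 N) 2) :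
    heckeT (Gamma0 N) 2 p (ramanujanEight N 2 x) = ramanujanEight N 2 (heckeT (Gamma0 N) 2 p x) := by
  have hp2 : p ≠ 2 := by rintro rfl; exact hpN ((show (2 : ℕ) ∣ 64 by norm_num).trans h64)
  have hodd : Odd p := hp.odd_of_ne_two hp2
  have hc : ∀ n, cexp (2 * π * Complex.I * ((((1 : ℕ) : ℤ) : ℝ) / (8 : ℕ) : ℝ)) ^ n +
        cexp (2 * π * Complex.I * ((((3 : ℕ) : ℤ) : ℝ) / (8 : ℕ) : ℝ)) ^ n +
        cexp (2 * π * Complex.I * ((((5 : ℕ) : ℤ) : ℝ) / (8 : ℕ) : ℝ)) ^ n +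
        cexp (2 * π * Complex.I * ((((7 : ℕ) : ℤ) : ℝ) / (8 : ℕ) : ℝ)) ^ n =
      (cexp (2 * π * Complex.I * ((((1 : ℕ) : ℤ) : ℝ) / (8 : ℕ) : ℝ)) ^ 1) ^ n +
        (cexp (2 * π * Complex.I * ((((1 : ℕ) : ℤ) : ℝ) / (8 : ℕ) : ℝ)) ^ 3) ^ n +
        (cexp (2 * π * Complex.I * ((((1 : ℕ) : ℤ) : ℝ) / (8 : ℕ) : ℝ)) ^ 5) ^ n +
        (cexp (2 * π * Complex.I * ((((1 : ℕ) : ℤ) : ℝ) / (8 : ℕ) : ℝ)) ^ 7) ^ n := fun n => by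
    rw [pow_one, cexp_two_pi_I_eighth_nat 3, cexp_two_pi_I_eighth_nat 5, cexp_two_pi_I_eighth_nat 7]
  refine eq_of_forall_cuspCoeff_eq_gamma0 fun n => ?_
  simp only [cuspCoeff_heckeT_weight_two hp, cuspCoeff_ramanujanEight_two h64, if_neg hpN, hc]
  rw [c8_odd_mul hodd]
  by_cases hpn : p ∣ n
  · obtain ⟨m, rfl⟩ := hpn
    rw [if_pos (dvd_mul_right p m), if_pos (dvd_mul_right p m), Nat.mul_div_cancel_left m hp.pos, c8_odd_mul hodd]
    ring
  · rw [if_neg hpn, if_neg hpn]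
    ring

/-- **`T_p S^{G,R} ⊆ S^{G,R}`** (`4 ∣ N`, `p ∤ N` prime): imc's End-saturated Conway lattice is a `𝕋^{(N)}`-module
(`T_p` commutes with `w_Q`, `t`, `R₄`, `R₈` and preserves integrality). -/
theorem map_heckeT_endSaturatedConwayLattice_le (h4 : 4 ∣ N) {p : ℕ} [NeZero p] (hp : p.Prime) (hpN : ¬ p ∣ N) :
    (endSaturatedConwayLattice N).map ((heckeT (Gamma0 N) 2 p).restrictScalars ℤ) ≤ endSaturatedConwayLattice N := by
  have hp2 : p ≠ 2 := by
    rintro rfl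
    exact hpN ((show (2 : ℕ) ∣ 4 by norm_num).trans h4)
  set L := endSaturatedConwayLattice N with hLdef
  -- closure properties of `L`
  have hLS : L ≤ integralCuspForms0 N 2 := sSup_le fun M hM => hM.1
  have hstab : ∀ (T : CuspForm (Gamma0 N) 2 →ₗ[ℂ] CuspForm (Gamma0 N) 2),
      (∀ M ∈ {M : Submodule ℤ (CuspForm (Gamma0 N) 2) | M ≤ integralCuspForms0 N 2 ∧ (∀ q : ℕ, q.Prime → q ∣ N →
        M.map ((atkinLehnerInvolutionAt N 2 q).restrictScalars ℤ) ≤ M) ∧ M.map ((halfTranslate N 2).restrictScalars ℤ) ≤ M ∧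
        (16 ∣ N → M.map ((ramanujanFour N 2).restrictScalars ℤ) ≤ M) ∧
        (64 ∣ N → M.map ((ramanujanEight N 2).restrictScalars ℤ) ≤ M)}, M.map (T.restrictScalars ℤ) ≤ M) →
      ∀ x ∈ L, T x ∈ L := by
    intro T hT x hx
    have h : L.map (T.restrictScalars ℤ) ≤ L := by
      rw [hLdef]; unfold endSaturatedConwayLattice
      rw [Submodule.map_le_iff_le_comap]
      exact sSup_le fun M hM => Submodule.map_le_iff_le_comap.mp ((hT M hM).trans (le_sSup hM))
    exact h ⟨x, hx, rfl⟩
  have hLw : ∀ q : ℕ, q.Prime → q ∣ N → ∀ x ∈ L, atkinLehnerInvolutionAt N 2 q x ∈ L :=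
    fun q hq hqN => hstab _ fun M hM => hM.2.1 q hq hqN
  have hLt : ∀ x ∈ L, halfTranslate N 2 x ∈ L := hstab _ fun M hM => hM.2.2.1
  have hL4 : 16 ∣ N → ∀ x ∈ L, ramanujanFour N 2 x ∈ L := fun h16 => hstab _ fun M hM => hM.2.2.2.1 h16
  have hL8 : 64 ∣ N → ∀ x ∈ L, ramanujanEight N 2 x ∈ L := fun h64 => hstab _ fun M hM => hM.2.2.2.2 h64
  refine le_sSup ⟨?_, ?_, ?_, ?_, ?_⟩
  · rintro _ ⟨x, hx, rfl⟩
    exact heckeT_mem_integralCuspForms0 p hp hpN (hLS hx)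
  · rintro q hq hqN _ ⟨_, ⟨x, hx, rfl⟩, rfl⟩
    refine ⟨atkinLehnerInvolutionAt N 2 q x, hLw q hq hqN x hx, ?_⟩
    change heckeT (Gamma0 N) 2 p (atkinLehnerInvolutionAt N 2 q x) = atkinLehnerInvolutionAt N 2 q (heckeT (Gamma0 N) 2 p x)
    exact (atkinLehnerInvolutionAt_heckeT_of_not_dvd' hq hqN hp hpN x).symm
  · rintro _ ⟨_, ⟨x, hx, rfl⟩, rfl⟩
    refine ⟨halfTranslate N 2 x, hLt x hx, ?_⟩
    change heckeT (Gamma0 N) 2 p (halfTranslate N 2 x) = halfTranslate N 2 (heckeT (Gamma0 N) 2 p x)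
    exact heckeT_halfTranslate_comm h4 hp hp2 x
  · rintro h16 _ ⟨_, ⟨x, hx, rfl⟩, rfl⟩
    refine ⟨ramanujanFour N 2 x, hL4 h16 x hx, ?_⟩
    change heckeT (Gamma0 N) 2 p (ramanujanFour N 2 x) = ramanujanFour N 2 (heckeT (Gamma0 N) 2 p x)
    exact heckeT_ramanujanFour_comm h16 hp hpN x
  · rintro h64 _ ⟨_, ⟨x, hx, rfl⟩, rfl⟩
    refine ⟨ramanujanEight N 2 x, hL8 h64 x hx, ?_⟩
    change heckeT (Gamma0 N) 2 p (ramanujanEight N 2 x) = ramanujanEight N 2 (heckeT (Gamma0 N) 2 p x)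
    exact heckeT_ramanujanEight_comm h64 hp hpN x

end Summit.BirchSwinnertonDyer.BirchSwinnertonDyer.Theorems.ManinLocalTwoThree

end
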